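import Summits.Schanuel.Schanuel.Theses.RoyCriterion
import Summits.Schanuel.Schanuel.Theorems.RoySmallValueDirichletGap.Negative.GapReduction
import Summits.Schanuel.Schanuel.Theorems.RoySmallValueDirichletGap.Negative.EtaNeZeroFalse
import Summits.Schanuel.Schanuel.Theorems.RoySmallValueDirichletGap.Negative.TauLtOneAndCountLeDegreeFalse
import Summits.Schanuel.Schanuel.Theorems.RoySmallValueDirichletGap.Negative.DirichletEdge

/-!
# Line `same-level-dirichlet-probe` for crux `RoySmallValueDirichletGap` (item stmt-Schanuel-1050) — crux-plan verdict: NO CONCLUDING SKELETON (transition step)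

Crux (route `RoyCriterion`): `Summit.Schanuel.Schanuel.Theses.RoyCriterion.RoySmallValueDirichletGap`
= Roy 2013 (arXiv:1301.0663) Thm 1.1 with `ν` pushed down to the Dirichlet edge `2 + β − τ`
(open content: `1 < τ < 2`, `0 < δ := ν − (2+β−τ) ≤ δ_R := (τ−1)(2−τ)/(β+1−τ)`; landed
`roySmallValueDirichletGap_iff_gap` / `_iff_nearEdge`).

Idea `same-level-dirichlet-probe` (crux-ideate r2 ideator 4; TRIAGE-r2-1/2/3: pass, merge with
`two-sided-absorption-transfer`): in Roy's §7 Step 4 replace the lower-level witness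
`P* = 𝒟^{i₀}P̃_{D*}` by an INTEGER POINT OF A SUB-DIRICHLET BODY
`𝒞♮(D'') = {Q : deg ≤ D'', ‖Q‖ ≤ e^{D''^{β+δ−ε}}, |𝒟ⁱQ(γ)| ≤ e^{−D''^{2+β−τ+ε'}} (i < c'D^τ)}`,
`D'' ∈ [D^{1−κ}, D]` — these exist at EVERY point (Dirichlet; landed `hyp_below_edge`) and the
Step-4/5 exchange rate is `T/T'' = O(1)` instead of `(D/D*)^τ`, so (kernel-checked bookkeeping
`probeBookkeeping_holds` of SketchIdeator4) every such `Q` must VANISH on Roy's enemy `Z_D` to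
order `≍ D^τ`, for EVERY `δ > 0`: the enemy is "Dirichlet-rigid"; likewise `𝒟ʲP̃_D ∈ I(Z_D)` for
`j < 3T − O(T D^{−δ})` ("absorption").

## Verdict and what this file certifies (lean check rc 0; `sorry` only in the three `stub_*` of §2)

The lever is TRUE and provable (it is the tree's `Roy2013.ZeroConfigK.step45_combined` run with
`(Ds, Ts) := (D'', ⌊c'D^τ⌋)` plus `probeBookkeeping_holds`), but it has NO CONCLUDING STEP: the
card's own S2 ("price the transition `Z_old → Z_new` by lattice / Hilbert-function counting on the
overlap levels where one polynomial vanishes to order `≈ 3T'` on both enemies") cannot be stated as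
a true lemma —
* (W) any statement whose use of the data is confined to levels `[D^a, D^A]` around one `D` is
  REALISED at the transcendental point `(0, η∞)` (landed `…Negative.FrequentlyFalse`; TRIAGE-r2-3
  "window witness": rigidity + `(3−o(1))T` absorption + a `D`-parameter family of exact relations
  all occur there on `[D^{0.78}, D^{1.22}]`), so an overlap-local S2 is false;
* (B) at one level two enemies killed to order `3T'` by `P̃_{D'}` and a coprime `Q_{D'}` give only
  Bézout `3T'(d_old + d_new) ≤ D'²` — no tension (TRIAGE-r2-2); the fat body's own height of `ℙ²`
  (`−c'T·U'' + 3D²Y''`, Prop 6.1) is negative iff `ε + ε' > δ` iff the body is UNINHABITED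
  (`dirichlet_duality_balance` below): Dirichlet duality, no margin;
* (R) the rigidity datum is informationally EQUIVALENT to Roy's Step-2 closeness certificate:
  certificate ⇒ rigidity is the probe lemma (§2 `ProbeVanishing`, true for ANY certified orbit, no
  hypothesis polynomial needed), rigidity ⇒ certificate is Minkowski in the quotient lattice
  (BarrierNotesIdeator5 B4); so "approximate data ↦ exact data" imports nothing that the
  closeness-based levers (round 1 pair measures, ideator 6's TTE) did not already have;
* (E) probing at the lowest admissible level `D^{1−κ}` (`κ < δ/τ`, `probe_levels_above_birth`:
  probes never see below the birth level `D* ≍ D^{1−δ/(τ−1)}`) gives by Bézout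
  `deg Z_D ≤ D^{2−τ−2κ}/c'`, which beats Roy's `e(δ) = 2−τ−δ(1+β−τ)/(τ−1)` iff `β < τ+1−2/τ`,
  i.e. NEVER (`probe_degree_never_beats_roy`); and Roy's endgame does not use the degree bound anyway.

What IS certified here, for the lead / tenure planner / round 3:
* §1 the γ-SIDE DATA of a hypothetical counterexample as an elementary structure `EnemyData`
  (finite set of algebraic points of `ℂ×ℂˣ` with orbit-Liouville property, size bounds in terms of
  a birth level `D* ≤ A·D^{1−δ/(τ−1)}`, Roy's Step-2 MASS inequality and the SHARP two-term Step-4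
  CAP `−A(D*^β d + D* h)`; `radial_mass_excluded`: with the sharp cap the mass is necessarily
  TANGENTIAL — the crude cap `−23D*^{2+β−τ}` would admit radial Liouville-type towers
  `rational ↔ Liouville-sharp degree-D^{2−τ}` at special points, see the line card).
* §2 three provable-now stubs `stub_enemyTower` (Roy §7 Steps 1–4 instrumented, size L),
  `stub_probeVanishing` (THE LEVER, γ-side, size M), `stub_hypothesisAbsorption` (size M) and the
  REAL composition `rigidAbsorbingEnemies_of` to the SUPPORT-level structure theorem
  `RigidAbsorbingEnemies` (cards same-level + two-sided + upward, merged as the triagers asked);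
  `rigidAbsorbingEnemies_of_crux` shows it is crux-implied (structure of counterexamples, never a
  residual); `probes_exist_top` shows `Rigid` is not vacuous (landed `hyp_below_edge`).
* §3 the honest residual, γ-side and polynomial-free: `NoRigidTangentialTower` (ideator 6's
  tangential-tower emptiness with this card's rigidity clause), and the CHECKED REDUCTION
  `crux_of_noRigidTangentialTower : EnemyTower → ProbeVanishing → NoRigidTangentialTower → crux`
  (hypotheses explicit; NOT registered as a skeleton: the residual is ≥ the crux — a uniform
  Hermite–Lindemann measure of Lang strength would be needed — and is not this idea's mechanism).
* §4 exponent bookkeeping behind (B), (E) and the probe-level range.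

Disproof.lean honoured: `η ≠ 0` (points of `EnemyData` lie in `𝒢`, Prop 4.2 transfer; landed
`roySmallValueDirichletGap_false_without_etaNeZero`, imported); `1 < τ` (`b = 1−δ/(τ−1)` in
`Dstar_le`; `…_false_without_oneLeTau`, imported); count `3⌊D^τ⌋ > D` is the crux's own
(`SmallValueHyp` verbatim; absorption order `3T − ⌈C D^{τ−δ}⌉ − D` needs it;
`…_false_of_count_le_degree`, imported); the Dirichlet edge is the ENGINE (`hyp_below_edge`,
imported and used in `probes_exist_top`); §6 uniformity: `EnemyTower` keeps `∀ᶠ D`. No statement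
of this file is an instance of a landed Negative lemma.
-/

set_option linter.dupNamespace false
set_option linter.unusedVariables false

noncomputable section

namespace Summit.Schanuel.Schanuel.Cruxes.RoySmallValueDirichletGap.SameLevelDirichletProbe

open scoped BigOperators
open Filter Complex
open Literature.NumberTheory.Transcendental
open Summit.Schanuel.Schanuel.Theses.RoyCriterion (RoySmallValueDirichletGap)

/-! ## §0 The crux read back -/

/-- The small-value hypothesis of the crux at `(ξ, η)` with exponents `(β, τ, ν)` — the verbatim
sub-formula of `RoySmallValueDirichletGap`. [cite: Roy2013, Theorem 1.1 (hypothesis)] -/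
def SmallValueHyp (ξ η : ℂ) (β τ ν : ℝ) : Prop :=
  ∀ᶠ D : ℕ in atTop, ∃ P : MvPolynomial (Fin 2) ℤ, P ≠ 0 ∧ P.totalDegree ≤ D ∧
    (mvPolyHeight P : ℝ) ≤ Real.exp ((D : ℝ) ^ β) ∧
    ∀ i : ℕ, i < 3 * ⌊(D : ℝ) ^ τ⌋₊ →
      ‖MvPolynomial.aeval ![ξ, η] (royD^[i] P)‖ ≤ Real.exp (-(D : ℝ) ^ ν)

/-- The hypothesis in SEQUENCE form (`P D` is Roy's `P_D`). -/
def SmallValueSeq (P : ℕ → MvPolynomial (Fin 2) ℤ) (ξ η : ℂ) (β τ ν : ℝ) : Prop :=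
  ∀ᶠ D : ℕ in atTop, P D ≠ 0 ∧ (P D).totalDegree ≤ D ∧
    (mvPolyHeight (P D) : ℝ) ≤ Real.exp ((D : ℝ) ^ β) ∧
    ∀ i : ℕ, i < 3 * ⌊(D : ℝ) ^ τ⌋₊ →
      ‖MvPolynomial.aeval ![ξ, η] (royD^[i] (P D))‖ ≤ Real.exp (-(D : ℝ) ^ ν)

/-- Roy's printed correction term `δ_R = (τ−1)(2−τ)/(β+1−τ)`. [cite: Roy2013, Theorem 1.1, (1.1)] -/
def royGap (β τ : ℝ) : ℝ := (τ - 1) * (2 - τ) / (β + 1 - τ)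

/-- READ-BACK: the crux verbatim in terms of `SmallValueHyp`. -/
theorem crux_iff : RoySmallValueDirichletGap ↔
    ∀ (ξ η : ℂ), η ≠ 0 → ∀ (β τ ν : ℝ), 1 ≤ τ → τ < 2 → τ < β → 2 + β - τ < ν →
      SmallValueHyp ξ η β τ ν → IsAlgebraic ℚ ξ ∧ IsAlgebraic ℚ η := Iff.rfl

/-- `δ_R > 0` on the open range. -/
theorem royGap_pos {β τ : ℝ} (h1 : 1 < τ) (h2 : τ < 2) (hβ : τ < β) : 0 < royGap β τ :=
  div_pos (mul_pos (by linarith) (by linarith)) (by linarith)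

/-- `δ_R = 0` at `τ = 1`. -/
@[simp] theorem royGap_one (β : ℝ) : royGap β 1 = 0 := by simp [royGap]

/-- A sequence realising the hypothesis gives the hypothesis. -/
theorem smallValueHyp_of_seq {P : ℕ → MvPolynomial (Fin 2) ℤ} {ξ η : ℂ} {β τ ν : ℝ}
    (h : SmallValueSeq P ξ η β τ ν) : SmallValueHyp ξ η β τ ν :=
  h.mono fun D hD => ⟨P D, hD⟩

/-- The hypothesis yields a sequence (choice). -/
theorem smallValueSeq_of_hyp {ξ η : ℂ} {β τ ν : ℝ} (h : SmallValueHyp ξ η β τ ν) :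
    ∃ P : ℕ → MvPolynomial (Fin 2) ℤ, SmallValueSeq P ξ η β τ ν := by
  classical
  refine ⟨fun D => if hD : ∃ P : MvPolynomial (Fin 2) ℤ, P ≠ 0 ∧ P.totalDegree ≤ D ∧
        (mvPolyHeight P : ℝ) ≤ Real.exp ((D : ℝ) ^ β) ∧
        ∀ i : ℕ, i < 3 * ⌊(D : ℝ) ^ τ⌋₊ →
          ‖MvPolynomial.aeval ![ξ, η] (royD^[i] P)‖ ≤ Real.exp (-(D : ℝ) ^ ν)
      then hD.choose else 0, ?_⟩
  filter_upwards [h] with D hD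
  simp only [dif_pos hD]
  exact hD.choose_spec

/-! ## §1 The γ-side data of a hypothetical counterexample -/

/-- Distance from the affine point `α = (x, y)` to the LEAF `A_γ = {(ξ+z, ηe^z)}` through
`γ = (ξ, η)`: `|y − η e^{x−ξ}|` (Roy's `dist(α, A_γ)` in the chart `α₀ = 1`).
[cite: Roy2013, §4 (p. 11)] -/
def leafDist (ξ η : ℂ) (α : ℂ × ℂ) : ℝ := ‖α.2 - η * cexp (α.1 - ξ)‖

/-- Roy's closeness term `max{T·log dist(α, γ), log dist(α, A_γ)}` (with the tree's guard: if `α`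
lies ON the leaf the second entry is replaced by the first). [cite: Roy2013, §7, Step 2] -/
def closeness (ξ η : ℂ) (T : ℕ) (α : ℂ × ℂ) : ℝ :=
  max ((T : ℝ) * Real.log (dist α (ξ, η)))
    (if 0 < leafDist ξ η α then Real.log (leafDist ξ η α) else (T : ℝ) * Real.log (dist α (ξ, η)))

/-- `Q` vanishes to `𝒟₁`-order `m` at `α = (x, y)` (exact zero of order `m` of
`z ↦ Q(x + z, y e^z)`). -/
def VanishesToOrder (Q : MvPolynomial (Fin 2) ℤ) (α : ℂ × ℂ) (m : ℕ) : Prop :=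
  ∀ i : ℕ, i < m → MvPolynomial.aeval ![α.1, α.2] (royD^[i] Q) = 0

/-- The SUB-DIRICHLET PROBE BODY at level `D` with `T` jets: nonzero integer `Q`, `deg Q ≤ D`,
`‖Q‖ ≤ e^Y`, `|𝒟₁ⁱQ(ξ,η)| ≤ e^{−U}` for `i < T`. Inhabited at EVERY point once
`T·U < (D²/2)·Y` asymptotically (Dirichlet; `probes_exist_top`). [cite: Roy2013, p. 3] -/
def SubDirichletBody (D T : ℕ) (ξ η : ℂ) (Y U : ℝ) : Set (MvPolynomial (Fin 2) ℤ) :=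
  {Q | Q ≠ 0 ∧ Q.totalDegree ≤ D ∧ (mvPolyHeight Q : ℝ) ≤ Real.exp Y ∧
    ∀ i : ℕ, i < T → ‖MvPolynomial.aeval ![ξ, η] (royD^[i] Q)‖ ≤ Real.exp (-U)}

/-- **γ-side ENEMY DATA at level `D`** (what Roy §7 Steps 1–4 extract from a counterexample, with the
hypothesis polynomials FORGOTTEN): a finite set `S` of algebraic points of `𝒢 = ℂ × ℂˣ` (Roy's
`Z_D(ℂ)`, `d = #S = deg Z_D`) behaving like ONE Galois orbit for integer polynomials (`orbitLike`)
with Roy's product-formula / Liouville inequality (2.2) at orbit height `h = h(Z_D) ≥ 0`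
(`liouville`: no `‖Q‖` term — this is what excludes junk `S`), a birth level `D* ≤ A·D^{1−δ/(τ−1)}`
carrying the Step-3 size bounds `d ≤ A·D*^{2−τ}`, `h ≤ A·D*^{1+β−τ}`, the near set `U ⊆ S`
(affine radius `c₂ = max{1,|ξ|,|η|}`), the Step-2 MASS inequality with budget
`κ₁ D^δ (D^β d + D h)`, and the SHARP Step-4 CAP `∑_{S'} max{T* log ρ, log ε} ≥ −A(D*^β d + D* h)`
for every `S' ⊆ U` (two-term form of Roy p. 19; with it the mass is forced onto TANGENTIAL points,
`radial_mass_excluded`). All constants affine; `A, κ₁` depend on `γ` and Roy's constants.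
[cite: Roy2013, §7, Steps 2–4; Proposition 2.3 (2.2); Proposition 6.4] -/
structure EnemyData (ξ η : ℂ) (β τ δ A κ₁ : ℝ) (D : ℕ) where
  /-- the points of the enemy `Z_D(ℂ) ⊂ 𝒢` (affine chart) -/
  S : Finset (ℂ × ℂ)
  /-- the near set `𝒰` -/
  U : Finset (ℂ × ℂ)
  /-- the birth level `D*` (Roy §7 Step 3) -/
  Dstar : ℕ
  /-- the orbit height `h(Z_D)` -/
  h : ℝ
  nonempty : S.Nonempty
  mem_G : ∀ α ∈ S, IsAlgebraic ℚ α.1 ∧ IsAlgebraic ℚ α.2 ∧ α.2 ≠ 0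
  orbitLike : ∀ Q : MvPolynomial (Fin 2) ℤ,
    (∃ α ∈ S, MvPolynomial.aeval ![α.1, α.2] Q ≠ 0) → ∀ α ∈ S, MvPolynomial.aeval ![α.1, α.2] Q ≠ 0
  h_nonneg : 0 ≤ h
  liouville : ∀ (N : ℕ) (Q : MvPolynomial (Fin 2) ℤ), Q.totalDegree ≤ N →
    (∀ α ∈ S, MvPolynomial.aeval ![α.1, α.2] Q ≠ 0) →
    -(7 * Real.log 3 * N * S.card + N * h) ≤ ∑ α ∈ S, Real.log ‖MvPolynomial.aeval ![α.1, α.2] Q‖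
  one_le_Dstar : 1 ≤ Dstar
  Dstar_le_D : Dstar ≤ D
  Dstar_le : (Dstar : ℝ) ≤ A * (D : ℝ) ^ (1 - δ / (τ - 1))
  card_le : (S.card : ℝ) ≤ A * (Dstar : ℝ) ^ (2 - τ)
  h_le : h ≤ A * (Dstar : ℝ) ^ (1 + β - τ)
  U_sub : U ⊆ S
  U_near : ∀ α ∈ U, dist α (ξ, η) ≤ max 1 (max ‖ξ‖ ‖η‖)
  mass : ∑ α ∈ U, closeness ξ η ⌊(D : ℝ) ^ τ⌋₊ α ≤
    -(κ₁ * (D : ℝ) ^ δ * ((D : ℝ) ^ β * S.card + D * h))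
  cap : ∀ S' ⊆ U, -(A * ((Dstar : ℝ) ^ β * S.card + Dstar * h)) ≤
    ∑ α ∈ S', closeness ξ η ⌊(Dstar : ℝ) ^ τ⌋₊ α

/-- Parameters of the probe family: `ε` (height slack), `ε'` (smallness slack), `κ` (level range
`[D^{1−κ}, D]`), `c'` (jet count `⌊c'D^τ⌋`), `c` (vanishing order `⌊c·c'D^τ⌋`). -/
structure RigidityParams where
  ε : ℝ
  ε' : ℝ
  κ : ℝ
  c : ℝ
  c' : ℝ

/-- Admissible probe parameters: strictly below the Dirichlet edge (`ε + ε' < δ`), genuine level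
range and order, and at most the crux's own jet count (`c' ≤ 1`). The probe lemma moreover needs
the floor `max{0,(2τ−3)/(τ−1)}·δ < ε + ε'` and `κ` small (`inhabited_at_lowest_level_iff`); those are
for the prover of `stub_probeVanishing` to choose — `Admissible` only records what the residual
`NoRigidTangentialTower` may assume. -/
def RigidityParams.Admissible (r : RigidityParams) (β τ δ : ℝ) : Prop :=
  0 < r.ε ∧ 0 < r.ε' ∧ r.ε + r.ε' < δ ∧ 0 < r.κ ∧ r.κ < 1 ∧ 0 < r.c ∧ r.c < 1 ∧ 0 < r.c' ∧ r.c' ≤ 1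

/-- **DIRICHLET-RIGIDITY of a finite set `S` at level `D`**: every integer point of the sub-Dirichlet
body `𝒞♮(D'') = SubDirichletBody D'' ⌊c'D^τ⌋ ξ η (D''^{β+δ−ε}) (D''^{2+β−τ+ε'})` at every level
`D'' ∈ [D^{1−κ}, D]` vanishes on `S` to `𝒟₁`-order `⌊c·c'D^τ⌋`. A statement about `γ` and `S`
only (the body is defined from `γ`). -/
def Rigid (ξ η : ℂ) (β τ δ : ℝ) (r : RigidityParams) (D : ℕ) (S : Finset (ℂ × ℂ)) : Prop :=
  ∀ D'' : ℕ, (D : ℝ) ^ (1 - r.κ) ≤ D'' → D'' ≤ D →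
    ∀ Q ∈ SubDirichletBody D'' ⌊r.c' * (D : ℝ) ^ τ⌋₊ ξ η ((D'' : ℝ) ^ (β + δ - r.ε))
        ((D'' : ℝ) ^ (2 + β - τ + r.ε')),
      ∀ α ∈ S, VanishesToOrder Q α ⌊r.c * (r.c' * (D : ℝ) ^ τ)⌋₊

/-- **Non-vacuity of `Rigid`**: at the top level `D'' = D` the probe body is inhabited for all large
`D` at EVERY point, for admissible parameters (`ε + ε' < δ`, `c' ≤ 1`): this is the landed Dirichlet
box principle `hyp_below_edge` at exponents `(β+δ−ε, τ, 2+β−τ+ε')`. [cite: Roy2013, p. 3] -/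
theorem probes_exist_top (ξ η : ℂ) {β τ δ : ℝ} (r : RigidityParams) (h1 : 1 < τ) (h2 : τ < 2)
    (hβ : τ < β) (hδ : 0 < δ) (hr : r.Admissible β τ δ) :
    ∀ᶠ D : ℕ in atTop, (SubDirichletBody D ⌊r.c' * (D : ℝ) ^ τ⌋₊ ξ η ((D : ℝ) ^ (β + δ - r.ε))
      ((D : ℝ) ^ (2 + β - τ + r.ε'))).Nonempty := by
  obtain ⟨hε, hε', hsum, -, -, -, -, hc'0, hc'1⟩ := hr
  have hedge : 2 + β - τ + r.ε' < 2 + (β + δ - r.ε) - τ := by linarith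
  have hβ' : τ < β + δ - r.ε := by linarith
  have hD := Summit.Schanuel.Schanuel.Theorems.RoySmallValueDirichletGapDirichlet.hyp_below_edge
    ξ η h1.le h2 hβ' hedge
  filter_upwards [hD] with D hD
  obtain ⟨P, hP0, hdeg, hht, hval⟩ := hD
  refine ⟨P, hP0, hdeg, hht, fun i hi => ?_⟩
  have hcount : ⌊r.c' * (D : ℝ) ^ τ⌋₊ ≤ 3 * ⌊(D : ℝ) ^ τ⌋₊ := by
    have hx : 0 ≤ (D : ℝ) ^ τ := Real.rpow_nonneg (Nat.cast_nonneg D) τ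
    calc ⌊r.c' * (D : ℝ) ^ τ⌋₊ ≤ ⌊(D : ℝ) ^ τ⌋₊ :=
          Nat.floor_le_floor (by nlinarith)
      _ ≤ 3 * ⌊(D : ℝ) ^ τ⌋₊ := by omega
  have := hval i (lt_of_lt_of_le hi hcount)
  simpa using this

/-! ## §2 The lever as provable stubs, and the SUPPORT-level structure theorem they give -/

/-- **Stub statement 1 — the enemy tower (Roy 2013 §7 Steps 1–4, instrumented; P-side ⇒ γ-side).**
If `η ≠ 0`, `(ξ, η) ∉ ℚ̄²`, `1 < τ < 2 < …`, `0 < δ ≤ δ_R` and the small-value hypothesis holds at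
`ν = 2+β−τ+δ`, then for some constants `A, κ₁ > 0` and all large `D` there is `EnemyData` at level
`D`: `S := Z_D(ℂ)` (Prop 6.2, a `ℚ`-irreducible 0-cycle in `𝒢` by Lemma 6.3 since `𝒰 ≠ ∅`),
`U := 𝒰`, `D* :=` Roy's birth level (Step 3, `→ ∞`, `≤ C D^{1−δ/(τ−1)}` by Step 5 (ii), which holds in
any counterexample), `h := h(Z_D)`; `orbitLike`/`liouville` = Prop 2.3 (2.2) in the affine chart
(`∑ log|Q(x,y)| = ∑ log|Q_hom(α_norm)| + N ∑ log‖(1,x,y)‖ ≥ −7log3·N d − N h`), size = Step 3,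
`mass` = last display of Step 2 (`κ₁ = 1/25` up to the affine conversion `O(T·d) ≪ D^{β+δ}d`),
`cap` = last display of Step 4 in its two-term form `−8D*^β d − D* h`. Why plausibly true: it is
Roy's proof minus Step 5's final comparison. Size L: the tree proves Theorem 1.1 inside one
`by_contra` (RoySmallValueMain.lean); the per-level objects (`LevelPkg.step2_level`,
`ZeroConfigK.step3_bounds`, `step4_orbit`) exist but must be re-exported with affine conversions.
[cite: Roy2013, §7, Steps 1–4] -/
def EnemyTower : Prop :=
  ∀ (ξ η : ℂ), η ≠ 0 → ¬ (IsAlgebraic ℚ ξ ∧ IsAlgebraic ℚ η) →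
  ∀ (β τ δ : ℝ), 1 < τ → τ < 2 → τ < β → 0 < δ → δ ≤ royGap β τ →
    SmallValueHyp ξ η β τ (2 + β - τ + δ) →
    ∃ A κ₁ : ℝ, 0 < A ∧ 0 < κ₁ ∧ ∀ᶠ D : ℕ in atTop, Nonempty (EnemyData ξ η β τ δ A κ₁ D)

/-- **Stub statement 2 — THE LEVER: Dirichlet-rigidity of every mass-certified orbit (γ-side; no
hypothesis polynomial).** For `η ≠ 0`, `1 < τ < 2 < …`, `δ > 0` and any constants `A, κ₁ > 0` there
are admissible probe parameters `r` such that, for all large `D`, EVERY `EnemyData` at level `D` is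
`Rigid`. Why true: let `Q ∈ ℤ[X] ∩ 𝒞♮(D'')` with `Q ∉ I(S)`; `liouville` (Prop 2.3 (2.2)) gives
`∑_S log|Q(α)| ≥ −(7log3 D'' d + D'' h)`, the crude bound `log|Q(α)| ≤ Y'' + O(D'')` and Prop 4.2
with `T'' = ⌊c'D^τ⌋` jets at the points of `U` give, once the floor
`U'' = D''^{2+β−τ+ε'} > 3Y''d + D''h` holds (size fields; exponent test
`max{0,(2τ−3)/(τ−1)}δ < ε+ε'`, `κ < δ/τ`), `∑_U max{T'' log ρ, log ε} ≥ −(3Y''d + D''h)`; as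
`T'' ≤ T`, `∑_U max{T log ρ, log ε} ≥ (T/T'')·∑_U min{…,0}`, so `mass` yields
`κ₁D^δ(D^β d + Dh) ≤ (1/c' + 1)(3D''^{β+δ−ε} d + D''h)` — impossible for large `D`
(`probeBookkeeping_holds`, SketchIdeator4, kernel-checked). Vanishing to ORDER `⌊c·c'D^τ⌋`: the same
with `𝒟ʲQ`, `j ≤ c·T''`, which keeps `(1−c)T''` small jets. Far points of `S ∖ U`: `orbitLike`. In
tree: `Roy2013.ZeroConfigK.step45_combined` (arbitrary integer form `R`, any `Ds, Ts`, factor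
`T/Ts + 1`) is exactly this computation in projective dress. Size M. [cite: Roy2013, §7, Steps 4–5;
Propositions 2.3, 4.2] -/
def ProbeVanishing : Prop :=
  ∀ (ξ η : ℂ), η ≠ 0 → ∀ (β τ δ : ℝ), 1 < τ → τ < 2 → τ < β → 0 < δ →
  ∀ (A κ₁ : ℝ), 0 < A → 0 < κ₁ →
    ∃ r : RigidityParams, r.Admissible β τ δ ∧
      ∀ᶠ D : ℕ in atTop, ∀ E : EnemyData ξ η β τ δ A κ₁ D, Rigid ξ η β τ δ r D E.S

/-- **Stub statement 3 — absorption of the hypothesis polynomial (P-side).** Under the hypothesis in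
sequence form at `ν = 2+β−τ+δ`, for some `C > 0` and all large `D`, `P_D` vanishes on every
`EnemyData` set `S` to `𝒟₁`-order `3⌊D^τ⌋ − ⌈C·D^{τ−δ}⌉ − D` (Roy's construction certifies only
`2⌊D^τ⌋`; the `−D` absorbs the homogenisation shift `X₁^aX₂^{−b}`). Why true: the probe argument of
stub 2 with `Q := 𝒟ʲP̃_D`, which has `s = 3T − j` small jets to `e^{−D^ν(1−o(1))}` and height
`e^{(1+o(1))D^β}`; the exchange rate `T/s` is `< κ₁D^δ/16` iff `s > (16/κ₁)T D^{−δ}`.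
Size M (same tree lemma). [cite: Roy2013, §7, Step 1 and Step 4] -/
def HypothesisAbsorption : Prop :=
  ∀ (ξ η : ℂ), η ≠ 0 → ∀ (β τ δ : ℝ), 1 < τ → τ < 2 → τ < β → 0 < δ →
  ∀ (A κ₁ : ℝ), 0 < A → 0 < κ₁ →
  ∀ (P : ℕ → MvPolynomial (Fin 2) ℤ), SmallValueSeq P ξ η β τ (2 + β - τ + δ) →
    ∃ C : ℝ, 0 < C ∧ ∀ᶠ D : ℕ in atTop, ∀ E : EnemyData ξ η β τ δ A κ₁ D,
      ∀ α ∈ E.S, VanishesToOrder (P D) α (3 * ⌊(D : ℝ) ^ τ⌋₊ - ⌈C * (D : ℝ) ^ (τ - δ)⌉₊ - D)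

/-- Stub 1 (Roy-internals exposure; hardest of the three in engineering terms). -/
theorem stub_enemyTower : EnemyTower := by
  sorry

/-- Stub 2 (the lever: `step45_combined` with `(Ds,Ts) := (D'', ⌊c'D^τ⌋)` + `probeBookkeeping_holds`). -/
theorem stub_probeVanishing : ProbeVanishing := by
  sorry

/-- Stub 3 (absorption: the same with `Q := 𝒟ʲP̃_D`). -/
theorem stub_hypothesisAbsorption : HypothesisAbsorption := by
  sorry

/-- **The SUPPORT-level structure theorem of the merged line (cards same-level-dirichlet-probe +
two-sided-absorption-transfer + upward-lethality-persistence): RIGID ABSORBING ENEMIES.** In any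
hypothetical counterexample at `ν = 2+β−τ+δ` (`0 < δ ≤ δ_R`), for all large `D` there is γ-side enemy
data `S = Z_D(ℂ)` which is Dirichlet-rigid on `[D^{1−κ}, D]` AND absorbs `P_D` to order
`(3−o(1))⌊D^τ⌋` — for EVERY `δ > 0` (no `δ_R` in the proof). Recommended as a SUPPORT item of route
`RoyCriterion` (kind support, rank 9): provable now from the three stubs, and crux-implied
(`rigidAbsorbingEnemies_of_crux`), hence never a residual. -/
def RigidAbsorbingEnemies : Prop :=
  ∀ (ξ η : ℂ), η ≠ 0 → ¬ (IsAlgebraic ℚ ξ ∧ IsAlgebraic ℚ η) →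
  ∀ (β τ δ : ℝ), 1 < τ → τ < 2 → τ < β → 0 < δ → δ ≤ royGap β τ →
  ∀ (P : ℕ → MvPolynomial (Fin 2) ℤ), SmallValueSeq P ξ η β τ (2 + β - τ + δ) →
    ∃ (A κ₁ C : ℝ) (r : RigidityParams), 0 < A ∧ 0 < κ₁ ∧ 0 < C ∧ r.Admissible β τ δ ∧
      ∀ᶠ D : ℕ in atTop, ∃ E : EnemyData ξ η β τ δ A κ₁ D,
        Rigid ξ η β τ δ r D E.S ∧
        ∀ α ∈ E.S, VanishesToOrder (P D) α (3 * ⌊(D : ℝ) ^ τ⌋₊ - ⌈C * (D : ℝ) ^ (τ - δ)⌉₊ - D)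

/-- **Composition (real proof): the three stubs give `RigidAbsorbingEnemies`.** -/
theorem rigidAbsorbingEnemies_of (h₁ : EnemyTower) (h₂ : ProbeVanishing)
    (h₃ : HypothesisAbsorption) : RigidAbsorbingEnemies := by
  intro ξ η hη hna β τ δ hτ1 hτ2 hβ hδ hδR P hP
  obtain ⟨A, κ₁, hA, hκ₁, hT⟩ := h₁ ξ η hη hna β τ δ hτ1 hτ2 hβ hδ hδR (smallValueHyp_of_seq hP)
  obtain ⟨r, hr, hR⟩ := h₂ ξ η hη β τ δ hτ1 hτ2 hβ hδ A κ₁ hA hκ₁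
  obtain ⟨C, hC, hAbs⟩ := h₃ ξ η hη β τ δ hτ1 hτ2 hβ hδ A κ₁ hA hκ₁ P hP
  refine ⟨A, κ₁, C, r, hA, hκ₁, hC, hr, ?_⟩
  filter_upwards [hT, hR, hAbs] with D hD hRD hAD
  obtain ⟨E⟩ := hD
  exact ⟨E, hRD E, hAD E⟩

/-- The support skeleton instantiated on the (sorried) stubs: what a prover would close for the
SUPPORT statement — NOT for the crux. -/
theorem rigidAbsorbingEnemies_skeleton : RigidAbsorbingEnemies :=
  rigidAbsorbingEnemies_of stub_enemyTower stub_probeVanishing stub_hypothesisAbsorption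

/-- The structure theorem is CRUX-IMPLIED (vacuously: under the crux there is no transcendental
point with the hypothesis), so it is a statement about hypothetical counterexamples only — the
reason no statement of this shape can serve as the residual stub of a concluding skeleton. -/
theorem rigidAbsorbingEnemies_of_crux (h : RoySmallValueDirichletGap) : RigidAbsorbingEnemies := by
  intro ξ η hη hna β τ δ hτ1 hτ2 hβ hδ hδR P hP
  exact absurd (h ξ η hη β τ (2 + β - τ + δ) hτ1.le hτ2 hβ (by linarith) (smallValueHyp_of_seq hP)) hna

/-! ## §3 The honest residual (γ-side, polynomial-free) and the checked reduction -/

/-- **The residual: NO RIGID TANGENTIAL TOWER** (ideator 6's tangential-tower emptiness `TTE` in the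
elementary γ-side format of §1, with this card's rigidity clause). For every `(ξ, η) ∉ ℚ̄²` with
`η ≠ 0`, every `1 < τ < 2 < …`, `0 < δ ≤ δ_R`, all constants and all admissible probe parameters, it
is NOT the case that every large level `D` carries rigid enemy data. Status: NOT implied by the crux
(no hypothesis polynomial occurs), implies it (`crux_of_noRigidTangentialTower`); generically true
by counting (orbit entropy `(d+2)h ≲ D*^{3+β−2τ}` against the tangential mass cost
`2κ₁dD^{β+δ}`, margin `D^{τ−1}`, for ALL `1 < τ < 2`); radial Liouville-type towers are excluded
by the sharp cap (`radial_mass_excluded`); at special points it asks for the non-existence of chains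
of Hermite–Lindemann near-violations `|b − e^a| ≤ exp(−(entropy)^{r})`, `r = (β+δ)/(b(1+β−τ)) > 1`,
which no proved measure forbids (Nesterenko–Waldschmidt 1996 is bilinear in the log-heights) and
which a uniform measure of Lang strength would forbid. It is therefore ≥ the crux in difficulty and
is recorded as the RESIDUAL OF RECORD, not registered as a stub of this line.
[cite: Roy2013, §7, Step 5 (the un-excluded scenario)] -/
def NoRigidTangentialTower : Prop :=
  ∀ (ξ η : ℂ), η ≠ 0 → ¬ (IsAlgebraic ℚ ξ ∧ IsAlgebraic ℚ η) →
  ∀ (β τ δ : ℝ), 1 < τ → τ < 2 → τ < β → 0 < δ → δ ≤ royGap β τ →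
  ∀ (A κ₁ : ℝ), 0 < A → 0 < κ₁ →
  ∀ r : RigidityParams, r.Admissible β τ δ →
    ¬ (∀ᶠ D : ℕ in atTop, ∃ E : EnemyData ξ η β τ δ A κ₁ D, Rigid ξ η β τ δ r D E.S)

/-- **CHECKED REDUCTION (hypotheses explicit; not a registered skeleton):** the enemy tower (Roy
Steps 1–4), the probe lemma and tangential-tower emptiness together give the crux. Above `δ_R` this
is Roy's theorem in tree (`roy2013_thm_1_1_holds`); in the gap, a transcendental point would carry
rigid enemy data at every large level, which the residual forbids. -/
theorem crux_of_noRigidTangentialTower (h₁ : EnemyTower) (h₂ : ProbeVanishing)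
    (h₃ : NoRigidTangentialTower) : RoySmallValueDirichletGap := by
  intro ξ η hη β τ ν hτ1 hτ2 hβ hν hyp
  by_contra hna
  rcases lt_or_ge (2 + β - τ + royGap β τ) ν with hR | hR
  · exact hna (roy2013_thm_1_1_holds ξ η hη β τ ν hτ1 hτ2 hβ (by unfold royGap at hR; linarith) hyp)
  · have hτ1' : 1 < τ := by
      rcases hτ1.lt_or_eq with h | h
      · exact h
      · exfalso; subst h; simp at hR; linarith
    obtain ⟨δ, hδ⟩ : ∃ δ : ℝ, δ = ν - (2 + β - τ) := ⟨_, rfl⟩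
    have hδ0 : 0 < δ := by rw [hδ]; linarith
    have hδR : δ ≤ royGap β τ := by rw [hδ]; linarith
    have hyp' : SmallValueHyp ξ η β τ (2 + β - τ + δ) := by
      have hν' : 2 + β - τ + δ = ν := by rw [hδ]; ring
      rw [hν']
      exact hyp
    obtain ⟨A, κ₁, hA, hκ₁, hT⟩ := h₁ ξ η hη hna β τ δ hτ1' hτ2 hβ hδ0 hδR hyp'
    obtain ⟨r, hr, hP⟩ := h₂ ξ η hη β τ δ hτ1' hτ2 hβ hδ0 A κ₁ hA hκ₁
    refine h₃ ξ η hη hna β τ δ hτ1' hτ2 hβ hδ0 hδR A κ₁ hA hκ₁ r hr ?_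
    filter_upwards [hT, hP] with D hD hPD
    obtain ⟨E⟩ := hD
    exact ⟨E, hPD E⟩

/-! ## §4 Exponent bookkeeping (why the lever has no concluding step of its own) -/

/-- **Sharp cap ⇒ tangential mass (why `EnemyData.cap` is two-term).** For radial points (leaf
distance ≍ point distance) `closeness` at `T*` and at `T` coincide (`= log ε`), so `cap` with
`S' = U` and `mass` would give `κ₁D^δ(D^βd + Dh) ≤ A(D*^βd + D*h)`: impossible for large `D`,
TERMWISE, whatever `d ≥ 1`, `h ≥ 0`, `D* ≤ D`. (With the crude cap `−23D*^{2+β−τ}` this fails for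
`δ < (2−τ)(τ−1)/(1+β)`, and radial towers `rational ↔ Liouville-sharp degree-D^{2−τ}` would satisfy
the data at special points for `τ < 4/3`; see the line card.) [cite: Roy2013, §7, Step 5] -/
theorem radial_mass_excluded {A κ₁ δ β : ℝ} (hA : 0 < A) (hκ₁ : 0 < κ₁) (hδ : 0 < δ) (hβ : 0 ≤ β) :
    ∀ᶠ D : ℕ in atTop, ∀ (d h Ds : ℝ), 1 ≤ d → 0 ≤ h → 0 ≤ Ds → Ds ≤ D →
      A * (Ds ^ β * d + Ds * h) < κ₁ * (D : ℝ) ^ δ * ((D : ℝ) ^ β * d + D * h) := by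
  have hlim : Tendsto (fun D : ℕ => (D : ℝ) ^ δ) atTop atTop :=
    (tendsto_rpow_atTop hδ).comp tendsto_natCast_atTop_atTop
  filter_upwards [hlim.eventually_gt_atTop (A / κ₁), eventually_ge_atTop 1] with D hD hD1 d h Ds hd hh hDs0 hDsD
  have hD0 : (0 : ℝ) < D := by exact_mod_cast hD1
  have hAκ : A < κ₁ * (D : ℝ) ^ δ := by
    have := (div_lt_iff₀ hκ₁).1 hD
    linarith [mul_comm ((D : ℝ) ^ δ) κ₁]
  have hpow : Ds ^ β ≤ (D : ℝ) ^ β := Real.rpow_le_rpow hDs0 hDsD hβ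
  have hsum_le : Ds ^ β * d + Ds * h ≤ (D : ℝ) ^ β * d + D * h := by
    have h1 : Ds ^ β * d ≤ (D : ℝ) ^ β * d := mul_le_mul_of_nonneg_right hpow (by linarith)
    have h2 : Ds * h ≤ (D : ℝ) * h := mul_le_mul_of_nonneg_right hDsD hh
    linarith
  have hpos : 0 < (D : ℝ) ^ β * d + D * h := by
    have : 0 < (D : ℝ) ^ β * d := mul_pos (Real.rpow_pos_of_pos hD0 β) (by linarith)
    have : 0 ≤ (D : ℝ) * h := mul_nonneg hD0.le hh
    linarith
  calc A * (Ds ^ β * d + Ds * h) ≤ A * ((D : ℝ) ^ β * d + D * h) :=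
        mul_le_mul_of_nonneg_left hsum_le hA.le
    _ < κ₁ * (D : ℝ) ^ δ * ((D : ℝ) ^ β * d + D * h) := mul_lt_mul_of_pos_right hAκ hpos

/-- **The O(1) exchange rate, pointwise** (the real-analysis heart of the probe lemma and of Roy's
Step 5 partition; tree: `le_ratio_add_one_mul`): for `0 < T'' ≤ T` and any reals `a = log ρ`,
`b = log ε`, `(T/T'')·min{max{T''a, b}, 0} ≤ max{Ta, b}`. Summed over `U` it turns the probe's
Liouville lower bound at `T''` jets into a lower bound for the Step-2 sum at `T` jets with loss factor
`T/T'' = 1/c'` (Roy: `T/T* = (D/D*)^τ`). [cite: Roy2013, §7, Step 5] -/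
theorem transfer_pointwise {T T'' a b : ℝ} (hT'' : 0 < T'') (hle : T'' ≤ T) :
    T / T'' * min (max (T'' * a) b) 0 ≤ max (T * a) b := by
  have hratio : 1 ≤ T / T'' := by rw [le_div_iff₀ hT'']; linarith
  rcases le_or_gt 0 (max (T'' * a) b) with h | h
  · rw [min_eq_right h, mul_zero]
    rcases le_max_iff.1 h with ha | hb
    · have ha' : 0 ≤ a := by
        rcases le_or_gt 0 a with h0 | h0
        · exact h0
        · have : T'' * a < 0 := mul_neg_of_pos_of_neg hT'' h0
          linarith
      have : 0 ≤ T * a := mul_nonneg (by linarith) ha'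
      exact le_trans this (le_max_left _ _)
    · exact le_trans hb (le_max_right _ _)
  · rw [min_eq_left h.le]
    rcases le_or_gt b (T'' * a) with hab | hab
    · rw [max_eq_left hab]
      have : T / T'' * (T'' * a) = T * a := by field_simp
      rw [this]
      exact le_max_left _ _
    · rw [max_eq_right hab.le]
      have hb : b < 0 := by rw [max_eq_right hab.le] at h; exact h
      have : T / T'' * b ≤ 1 * b := mul_le_mul_of_nonpos_right hratio hb.le
      rw [one_mul] at this
      exact le_trans this (le_max_right _ _)

/-- **Dirichlet duality at the fat body (obstruction (B)).** The probe body `𝒞♮(D)` with `c'D^τ`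
jets, height `D^{β+δ−ε}` and smallness `D^{2+β−τ+ε'}` is INHABITED iff `τ + (2+β−τ+ε') < 2+(β+δ−ε)`
iff `ε + ε' < δ`, while its height of `ℙ²` (`−c'T·U'' + 3D²Y''`, Prop 6.1's Schwarz bound, any
`c' ≤ 3`) is NEGATIVE in the exponent iff `2+β+ε' > 2+β+δ−ε` iff `δ < ε + ε'`: the two regimes are
complementary — a fat body carries no same-level contradiction. [cite: Roy2013, Proposition 6.1 and p. 3] -/
theorem dirichlet_duality_balance (β τ δ ε ε' : ℝ) :
    (τ + (2 + β - τ + ε') < 2 + (β + δ - ε) ↔ ε + ε' < δ) ∧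
      (2 + β + δ - ε < 2 + β + ε' ↔ δ < ε + ε') := by
  constructor <;> constructor <;> intro h <;> linarith

/-- **Inhabitedness at the lowest probe level.** At `D'' = D^{1−κ}` the body with `c'D^τ` jets is
Dirichlet-inhabited iff `τ < (1−κ)(τ + δ − ε − ε')`, i.e. iff `κ·(τ+δ−ε−ε') < δ−ε−ε'`; in particular
`κ < δ/τ`. [cite: Roy2013, p. 3] -/
theorem inhabited_at_lowest_level_iff (τ δ ε ε' κ : ℝ) :
    τ < (1 - κ) * (τ + δ - ε - ε') ↔ κ * (τ + δ - ε - ε') < δ - ε - ε' := by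
  constructor <;> intro h <;> nlinarith

/-- … and therefore `κ < δ/τ` (for `τ > 0`, `ε, ε' > 0`, `ε + ε' < δ`, `κ > 0`). -/
theorem kappa_lt_of_inhabited {τ δ ε ε' κ : ℝ} (hτ : 0 < τ) (hε : 0 < ε) (hε' : 0 < ε')
    (hs : ε + ε' < δ) (hκ : 0 < κ) (h : κ * (τ + δ - ε - ε') < δ - ε - ε') : κ < δ / τ := by
  rw [lt_div_iff₀ hτ]
  have hs' : 0 < δ - ε - ε' := by linarith
  nlinarith [mul_pos hκ hs']

/-- **Probes live only above the birth level (obstruction (E), first half).** With `κ < δ/τ` the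
lowest probe level `D^{1−κ}` exceeds Roy's birth scale `D^{1−δ/(τ−1)}`: `1 − δ/(τ−1) < 1 − κ`.
So the fat probes exist only where the thin hypothesis polynomials already kill the enemy.
[cite: Roy2013, §7, Step 5 (ii)] -/
theorem probe_levels_above_birth {τ δ κ : ℝ} (hτ : 1 < τ) (hδ : 0 < δ) (hκ : κ < δ / τ) :
    1 - δ / (τ - 1) < 1 - κ := by
  have h1 : δ / τ < δ / (τ - 1) := div_lt_div_of_pos_left hδ (by linarith) (by linarith)
  linarith

/-- **Probe-Bézout never beats Roy's degree exponent (obstruction (E), second half).** Probing at level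
`D^{1−κ}` bounds `deg Z_D ≤ D^{2−τ−2κ}/c'` (Prop 6.4 at that level with `≍ D^τ` jets), while Roy's
Step 5 (i) gives `deg Z_D ≪ D^{e(δ)}`, `e(δ) = 2 − τ − δ(1+β−τ)/(τ−1)`. For every admissible `κ`
(`κτ < δ`) and `β > τ`, `1 < τ < 2`: `e(δ) < 2 − τ − 2κ` — Roy's bound is always the sharper one
(the probe would win iff `β < τ + 1 − 2/τ < τ`). Cleared of the positive denominator `τ − 1`.
[cite: Roy2013, §7, Step 5 (i)] -/
theorem probe_degree_never_beats_roy {β τ δ κ : ℝ} (h1 : 1 < τ) (h2 : τ < 2) (hβ : τ < β)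
    (hδ : 0 < δ) (hκ : 0 < κ) (hκδ : κ * τ < δ) :
    2 * κ * (τ - 1) < δ * (1 + β - τ) := by
  have hτ0 : 0 < τ := by linarith
  -- `2κ(τ−1)τ < 2δ(τ−1)` and `2δ(τ−1) < δτ(1+β−τ)` since `τ(β−τ) + (2−τ) > 0`
  have hA : 2 * κ * (τ - 1) * τ < 2 * δ * (τ - 1) := by nlinarith
  have hB : 2 * δ * (τ - 1) < δ * (1 + β - τ) * τ := by nlinarith [mul_pos hδ (sub_pos.2 hβ)]
  nlinarith

/-- The same comparison in exponent form: `e(δ) < 2 − τ − 2κ`. -/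
theorem roy_degExp_lt_probe_degExp {β τ δ κ : ℝ} (h1 : 1 < τ) (h2 : τ < 2) (hβ : τ < β)
    (hδ : 0 < δ) (hκ : 0 < κ) (hκδ : κ * τ < δ) :
    2 - τ - δ * (1 + β - τ) / (τ - 1) < 2 - τ - 2 * κ := by
  have hτ : 0 < τ - 1 := by linarith
  have h := probe_degree_never_beats_roy h1 h2 hβ hδ hκ hκδ
  have : 2 * κ < δ * (1 + β - τ) / (τ - 1) := by
    rw [lt_div_iff₀ hτ]; linarith
  linarith

/-- **Roy's endgame is blind to the degree bound anyway**: Step 5 uses only `deg Z ≥ 1` and the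
HEIGHT bound; at the threshold `δ_R` the degree exponent already vanishes, `e(δ_R) = 0`.
[cite: Roy2013, §7, Step 5] -/
theorem degExp_royGap {β τ : ℝ} (h1 : 1 < τ) (hβ : τ < β) :
    2 - τ - royGap β τ * (1 + β - τ) / (τ - 1) = 0 := by
  unfold royGap
  have hτ : τ - 1 ≠ 0 := by intro h; linarith
  have hb : β + 1 - τ ≠ 0 := by intro h; linarith
  field_simp
  ring

end Summit.Schanuel.Schanuel.Cruxes.RoySmallValueDirichletGap.SameLevelDirichletProbe

end
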